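import Summits.NavierStokesRegularity.NavierStokesRegularity.Theorems.SoloRefuteLiuYong2026SlotEngine
import HarnessLib

/-!
# C138 `LiuYong2026` — downstream column at the print's energy class (`Step4_H1_upper/_abs` + `L^∞_t L²_x`)

Second-lineage object (ns-claims-refuter-6 g3, D-0090); NOT the token of record (`Step3_K41`, refuted by
`not_Step3_K41`, refuter-5 g3). Companion of the landed `not_Step4_H1_upper` / `not_Step4_H1_abs`
(`Theorems.SoloRefuteLiuYong2026Step4`: spike amplitude, unbounded energy): here the witness lies INSIDE the
print's literal 定理2.2 class `L^∞_t L²_x` too: the typed faces WITH a uniform kinetic-energy bound added as an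
antecedent are negated (`not_Step4_H1_upper_bdd`, `not_Step4_H1_abs_bdd` — strictly stronger than the landed
literal negations), plus the positive record `exists_boundedEnergy_cesaro_witness`.
Witness (slot engine `Theorems.SoloRefuteLiuYong2026SlotEngine`): unit bursts `u(t,x) = ψ(t − m) Re(e₁ e^{2πi 2^m x₀})`
on `t ∈ [m, m+1]`, `m = 0, 1, 2, …` — an exact classical, hence global Leray–Hopf, solution from `u(0) = 0` with
pressure `0` and a smooth divergence-free force; `ℰ(u(t)) ≤ 1/2` for all `t`; every wave vector is excited during
at most one unit slot, so the Cesàro spectrum is `Φ ≡ 0` (K41 upper bound and infrared bound hold trivially);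
yet `‖u(m + ½)‖²_{H¹} ≥ (1 + 4^m)/4 → ∞`. So 引理H.1's inference «time-averaged K41 upper bound (+ infrared bound)
⇒ sup-in-time `H^s` bounds» (附录H p.57 L8–L17, used at 命题4.4 p.18 L24–p.19 L4) fails in the bounded-energy
forced class as well. Barrier of record: `Literature/Barriers/NavierStokesRegularity/CesaroSpectrumNoSupControl.lean`.
WHAT THIS IS NOT: not a claim about NS regularity or blow-up; not a claim about any author beyond the typed
locator.
-/

noncomputable section

set_option linter.dupNamespace false

open MeasureTheory Filter Set Topology
open scoped ContDiff

namespace Summit.NavierStokesRegularity.NavierStokesRegularity.Theorems.LiuYong2026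

open Literature.Claims.NS.LiuYong2026
open Literature.Analysis Literature.Analysis.FluidPDE Literature.Analysis.FunctionSpaces
open Literature.Analysis.FunctionSpaces.Torus

section Norms

open Slot

variable (h : ℕ → ℝ) (K : ℕ → Z3) (c : ℕ → C3)

/-! ### The `H^s` norm from below by one coefficient -/

/-- One weighted coefficient bounds the squared `H^s` norm from below. -/
theorem weight_mul_enorm_coeff_sq_le (s : ℝ) (v : T3 → E3) (k : Z3) :
    ENNReal.ofReal (sobolevWeight s k ^ 2) * ‖coeff v k‖ₑ ^ 2 ≤
      Torus.eSobolevNorm s (EuclideanSpace.complexify ∘ v) ^ 2 := by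
  unfold Torus.eSobolevNorm coeff
  set F : Z3 → ENNReal := fun k' => ENNReal.ofReal (sobolevWeight s k' ^ 2) *
    ‖UnitAddTorus.mFourierCoeff (EuclideanSpace.complexify ∘ v) k'‖ₑ ^ 2 with hF
  have e : ((∑' k', F k') ^ (1 / 2 : ℝ)) ^ 2 = ∑' k', F k' := by
    rw [← ENNReal.rpow_natCast, ← ENNReal.rpow_mul]
    norm_num
  show F k ≤ ((∑' k', F k') ^ (1 / 2 : ℝ)) ^ 2
  rw [e]
  exact ENNReal.le_tsum k

/-- The slot field at mid-slot: `u(m + ½) = h_m w_m`. -/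
theorem slotVel_mid (m : ℕ) : slotVel h K c (m + 1 / 2) = fun x => h m • slotMode K c m x := by
  have hfl : ⌊(m : ℝ) + 1 / 2⌋₊ = m :=
    (Nat.floor_eq_iff (by positivity)).2 ⟨by linarith, by linarith⟩
  funext x
  rw [slotVel, hfl, slotVelOne, slotAmp, show (m : ℝ) + 1 / 2 - m = 1 / 2 by ring, bumpFn_half, mul_one]

/-- `𝓕(w_m)(K m) = c_m / 2` when `K m ≠ −K m`. -/
theorem coeff_slotMode_self {m : ℕ} (hKm : K m ≠ -K m) :
    coeff (slotMode K c m) (K m) = (2 : ℂ)⁻¹ • c m := by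
  unfold coeff slotMode
  rw [mFourierCoeff_realTrigPoly_singleton, if_pos rfl, if_neg hKm, EuclideanSpace.conjVec_zero,
    add_zero]

/-- `‖𝓕(u(m+½))(K m)‖ = |h_m| ‖c_m‖ / 2`. -/
theorem norm_coeff_slotVel_mid {m : ℕ} (hKm : K m ≠ -K m) :
    ‖coeff (slotVel h K c (m + 1 / 2)) (K m)‖ = |h m| * ‖c m‖ / 2 := by
  rw [slotVel_mid, Spike.coeff_smul, coeff_slotMode_self K c hKm, norm_smul, norm_smul, Complex.norm_real,
    Real.norm_eq_abs, norm_inv, Complex.norm_ofNat]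
  ring

/-- **Uniform `H¹` bounds force `(1 + |K m|²) h_m² ‖c_m‖² / 4 ≤ C` for every slot.** -/
theorem sobolev_one_lower (hKm : ∀ m, K m ≠ -K m) (hU : UniformSobolevBounds (slotVel h K c)) :
    ∃ C : ℝ, ∀ m : ℕ, (1 + freqNormSq (K m)) * (|h m| * ‖c m‖ / 2) ^ 2 ≤ C := by
  obtain ⟨C, hC⟩ := hU 1 zero_le_one
  refine ⟨max C 0, fun m => ?_⟩
  have hle := (weight_mul_enorm_coeff_sq_le 1 (slotVel h K c (m + 1 / 2)) (K m)).trans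
    (hC (m + 1 / 2) (by positivity))
  rw [← ofReal_norm, norm_coeff_slotVel_mid h K c (hKm m), ← ENNReal.ofReal_pow (by positivity),
    ← ENNReal.ofReal_mul (sq_nonneg _), sobolevWeight_one_sq] at hle
  rcases (ENNReal.ofReal_le_ofReal_iff').1 hle with h' | h'
  · exact h'.trans (le_max_left _ _)
  · exact h'.trans (le_max_right _ _)

/-! ### Bounded kinetic energy -/

/-- `ℰ(u(t)) ≤ h_{⌊t⌋₊}² ‖c_{⌊t⌋₊}‖² / 2`: the glued field has bounded energy whenever the heights
and polarisations are bounded. -/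
theorem kineticEnergy_slotVel_le (t : ℝ) :
    Torus.kineticEnergy (slotVel h K c t) ≤ 2⁻¹ * (h ⌊t⌋₊ ^ 2 * ‖c ⌊t⌋₊‖ ^ 2) := by
  unfold Torus.kineticEnergy
  refine mul_le_mul_of_nonneg_left ?_ (by norm_num)
  have e : (fun x => ‖slotVel h K c t x‖ ^ 2) =
      fun x => slotAmp h ⌊t⌋₊ t ^ 2 * ‖slotMode K c ⌊t⌋₊ x‖ ^ 2 := by
    funext x
    show ‖slotAmp h ⌊t⌋₊ t • slotMode K c ⌊t⌋₊ x‖ ^ 2 = _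
    rw [norm_smul, mul_pow, Real.norm_eq_abs, sq_abs]
  rw [e, MeasureTheory.integral_const_mul]
  have hI : ∫ x, ‖slotMode K c ⌊t⌋₊ x‖ ^ 2 ≤ ‖c ⌊t⌋₊‖ ^ 2 :=
    integral_norm_sq_realTrigPoly_singleton_le (K ⌊t⌋₊) (fun _ => c ⌊t⌋₊)
  have ha : slotAmp h ⌊t⌋₊ t ^ 2 ≤ h ⌊t⌋₊ ^ 2 := by
    rw [slotAmp, mul_pow]
    have h1 : bumpFn (t - ⌊t⌋₊) ^ 2 ≤ 1 := by
      nlinarith [bumpFn_nonneg (t - ⌊t⌋₊), bumpFn_le_one (t - ⌊t⌋₊)]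
    nlinarith [sq_nonneg (h ⌊t⌋₊)]
  calc slotAmp h ⌊t⌋₊ t ^ 2 * ∫ x, ‖slotMode K c ⌊t⌋₊ x‖ ^ 2
      ≤ slotAmp h ⌊t⌋₊ t ^ 2 * ‖c ⌊t⌋₊‖ ^ 2 := mul_le_mul_of_nonneg_left hI (sq_nonneg _)
    _ ≤ h ⌊t⌋₊ ^ 2 * ‖c ⌊t⌋₊‖ ^ 2 := mul_le_mul_of_nonneg_right ha (sq_nonneg _)

end Norms

namespace Burst

open Slot

/-! ## The dyadic burst train `K m = (2^m, 0, 0)`, `c = e₁`, unit heights -/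

/-- Dyadic wave vectors `K m = (2^m, 0, 0)`. -/
def kvec (m : ℕ) : Z3 := Pi.single 0 (2 ^ m)

/-- The fixed unit polarisation `e₁ ⊥ K m`. -/
def cvec : C3 := EuclideanSpace.single 1 1

/-- Unit heights. -/
def hOne (_ : ℕ) : ℝ := 1

/-- `K m · e₁ = 0`. -/
theorem kvec_orth (m : ℕ) : ∑ j, ((kvec m j : ℂ)) * cvec j = 0 := by
  simp [kvec, cvec, Pi.single_apply]

/-- `(K m)₀ = 2^m`. -/
theorem kvec_apply_zero (m : ℕ) : kvec m 0 = 2 ^ m := by simp [kvec]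

/-- No antipodal coincidences `K n = −K m` (first coordinates are positive). -/
theorem kvec_ne_neg (n m : ℕ) : kvec n ≠ -kvec m := fun e => by
  have h1 := congrFun e 0
  simp only [Pi.neg_apply, kvec_apply_zero] at h1
  have : (0 : ℤ) < 2 ^ n := by positivity
  have : (0 : ℤ) < 2 ^ m := by positivity
  linarith

/-- The `±K n` are pairwise distinct across slots. -/
theorem kvec_inj (n m : ℕ) (e : kvec n = kvec m ∨ kvec n = -kvec m) : n = m := by
  rcases e with e | e
  · have h1 := congrFun e 0
    simp only [kvec_apply_zero] at h1
    exact Nat.pow_right_injective le_rfl (by exact_mod_cast h1)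
  · exact absurd e (kvec_ne_neg n m)

/-- `|K m|² = (2^m)²`. -/
theorem freqNormSq_kvec (m : ℕ) : freqNormSq (kvec m) = (2 ^ m) ^ 2 := by
  simp [freqNormSq, kvec, Pi.single_apply]

/-- `‖e₁‖ = 1`. -/
theorem norm_cvec : ‖cvec‖ = 1 := by
  rw [cvec, PiLp.norm_single]
  simp

/-- The witness velocity: unit bursts `ψ(t − m) Re(e₁ e^{2πi 2^m x₀})`, one per unit time slot. -/
def burstVel : ℝ → T3 → E3 := slotVel hOne kvec fun _ => cvec

/-- Its force. -/
def burstFrc : ℝ → T3 → E3 := slotFrc 1 hOne kvec fun _ => cvec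

/-- Admissible data (`ν = 1`). -/
theorem isData_burst : IsData 1 burstFrc (burstVel 0) :=
  isData_slotVel 1 hOne kvec _ one_pos kvec_orth

/-- Global Leray–Hopf (exact classical) solution from `u(0) = 0`. -/
theorem isGlobalLerayHopf_burst : Torus.IsGlobalLerayHopf 1 burstFrc (burstVel 0) burstVel :=
  isGlobalLerayHopf_slotVel 1 hOne kvec _ kvec_orth

/-- Cesàro spectrum `Φ ≡ 0`. -/
theorem hasCesaroSpectrum_burst : HasCesaroSpectrum burstVel (fun _ => 0) :=
  hasCesaroSpectrum_slotVel hOne kvec _ kvec_inj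

/-- **Bounded energy**: `ℰ(u(t)) ≤ 1/2` for all `t` (the print's literal `L^∞_t L²_x` class). -/
theorem kineticEnergy_burst_le (t : ℝ) : Torus.kineticEnergy (burstVel t) ≤ 2⁻¹ := by
  have h := kineticEnergy_slotVel_le hOne kvec (fun _ => cvec) t
  rw [hOne, norm_cvec] at h
  norm_num at h
  show Torus.kineticEnergy (slotVel hOne kvec (fun _ => cvec) t) ≤ 2⁻¹
  norm_num
  exact h

/-- **No uniform `H¹` bound**: `‖u(m + ½)‖²_{H¹} ≥ (1 + 4^m)/4`. -/
theorem not_uniformSobolevBounds_burst : ¬ UniformSobolevBounds burstVel := fun hU => by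
  obtain ⟨C, hC⟩ := sobolev_one_lower hOne kvec (fun _ => cvec) (fun m => kvec_ne_neg m m) hU
  obtain ⟨m, hm⟩ := pow_unbounded_of_one_lt (4 * C) (by norm_num : (1 : ℝ) < 2)
  have h := hC m
  rw [freqNormSq_kvec, hOne, norm_cvec, abs_one] at h
  have h1 : (1 : ℝ) ≤ 2 ^ m := one_le_pow₀ (by norm_num)
  nlinarith

end Burst

/-! ## Kills at the print's own energy class (charitable faces, inlined)

The literal negations `¬ Step4_H1_upper` / `¬ Step4_H1_abs` are already landed (`not_Step4_H1_upper`,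
`not_Step4_H1_abs` in `Theorems.SoloRefuteLiuYong2026Step4`, unbounded-energy spike witness; the gate dedups by
statement). Here the typed faces are WEAKENED by adding the print's 定理2.2 layer `u ∈ L^∞_t L²_x` — a uniform
kinetic-energy bound on the solution's time domain `t ≥ 0` — as an extra antecedent (inlined verbatim, no new
`def`; REF-lane-2 binder 09:08:50Z), and THOSE weaker statements are negated: strictly stronger theorems than the
landed ones, same slot-engine witness (`ℰ(burstVel t) ≤ 1/2`). -/

section Kills

open Slot Burst

/-- **`Step4_H1_upper` fails inside the bounded-energy class** (引理H.1, 附录H p.57 L8–L17, with 定理2.2's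
`L^∞_t L²_x` layer added to the antecedents). Witness: unit bursts on the modes `2^m e₀`, energy `≤ 1/2`,
Cesàro spectrum `Φ ≡ 0`, `‖u(m+½)‖²_{H¹} → ∞`. -/
theorem not_Step4_H1_upper_bdd :
    ¬ (∀ (ν : ℝ) (f : ℝ → T3 → E3) (u₀ : T3 → E3), IsData ν f u₀ →
      ∀ (u : ℝ → T3 → E3) (Φ : Z3 → ℝ), Torus.IsGlobalLerayHopf ν f u₀ u →
        (∃ E : ℝ, ∀ t : ℝ, 0 ≤ t → Torus.kineticEnergy (u t) ≤ E) →
        HasCesaroSpectrum u Φ → IsK41Upper Φ → InfraredBounded Φ → UniformSobolevBounds u) := fun h =>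
  not_uniformSobolevBounds_burst (h 1 burstFrc (burstVel 0) isData_burst burstVel (fun _ => 0)
    isGlobalLerayHopf_burst ⟨2⁻¹, fun t _ => kineticEnergy_burst_le t⟩ hasCesaroSpectrum_burst
    ⟨0, 0, fun k _ => by simp⟩ ⟨0, fun _ => le_rfl⟩)

/-- **`Step4_H1_abs` fails inside the bounded-energy class** (the function-level face, with the same uniform
kinetic-energy antecedent added). -/
theorem not_Step4_H1_abs_bdd :
    ¬ (∀ (u : ℝ → T3 → E3) (Φ : Z3 → ℝ), (∀ t : ℝ, 0 ≤ t → MemLp (u t) 2 volume) →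
      (∃ E : ℝ, ∀ t : ℝ, 0 ≤ t → Torus.kineticEnergy (u t) ≤ E) →
        HasCesaroSpectrum u Φ → IsK41Upper Φ → InfraredBounded Φ → UniformSobolevBounds u) := fun h =>
  not_Step4_H1_upper_bdd fun ν f u₀ _ u Φ hu hE hΦ hK hB => by
    refine h u Φ (fun t ht => ?_) hE hΦ hK hB
    rcases eq_or_lt_of_le ht with rfl | ht'
    · exact (hu 1 one_pos).memLp 0 ⟨le_rfl, zero_le_one⟩
    · exact (hu (t + 1) (by linarith)).memLp t ⟨ht, by linarith⟩

/-- **Companion (positive existence form).** A smooth divergence-free force `f` and a global Leray–Hopf solution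
`u` from `u(0) = 0` at `ν = 1` with `ℰ(u(t)) ≤ 1/2` for all `t`, Cesàro spectrum `Φ ≡ 0` (so the K41 upper
bound and the infrared bound hold), and no uniform-in-time Sobolev bounds. -/
theorem exists_boundedEnergy_cesaro_witness :
    ∃ (f : ℝ → T3 → E3) (u : ℝ → T3 → E3),
      IsData 1 f (u 0) ∧ Torus.IsGlobalLerayHopf 1 f (u 0) u ∧
      (∀ t : ℝ, Torus.kineticEnergy (u t) ≤ 2⁻¹) ∧ HasCesaroSpectrum u (fun _ => 0) ∧
      IsK41Upper (fun _ => 0) ∧ InfraredBounded (fun _ => 0) ∧ ¬ UniformSobolevBounds u :=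
  ⟨burstFrc, burstVel, isData_burst, isGlobalLerayHopf_burst, kineticEnergy_burst_le, hasCesaroSpectrum_burst,
    ⟨0, 0, fun k _ => by simp⟩, ⟨0, fun _ => le_rfl⟩, not_uniformSobolevBounds_burst⟩

/-- The bounded-energy kills re-derive the landed literal negations (examples only; the theorems of these exact
types are `not_Step4_H1_upper` / `not_Step4_H1_abs`). -/
example : ¬ Literature.Claims.NS.LiuYong2026.Step4_H1_upper := fun h =>
  not_Step4_H1_upper_bdd fun ν f u₀ hd u Φ hu _ => h ν f u₀ hd u Φ hu

example : ¬ Literature.Claims.NS.LiuYong2026.Step4_H1_abs := fun h =>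
  not_Step4_H1_abs_bdd fun u Φ hm _ => h u Φ hm

end Kills

end Summit.NavierStokesRegularity.NavierStokesRegularity.Theorems.LiuYong2026
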